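import Literature.NumberTheory.Sieve.SmoothCountSaddleCore
import Literature.NumberTheory.Sieve.SmoothZetaDecaySaddleRegimeA
import HarnessLib

/-!
# Hildebrand–Tenenbaum's Theorem 1 without zero-free regions, range `(log x)³ ≤ y ≤ x^{1/(log log y)³}`

Topic `Literature/NumberTheory/Sieve`; a PROVED tool file. Hildebrand–Tenenbaum [HildebrandTenenbaum1986, Thm 1] prove
`Ψ(x, y) = x^α ζ(α, y)/(α√(2πφ₂(α, y))) (1 + O(1/u + log y/y))` uniformly for `x ≥ y ≥ 2` (`α = α(x, y)` the saddle
point, `u = log x/log y`) from Perron's formula truncated at `T = Y(ε)` and Vinogradov's zero-free region (their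
Lemma 6). This file proves the theorem with the same main term and the error `O(1/u)` in the range
`(log x)³ ≤ y`, `u ≥ u₀`, `u ≥ (log log y)³`, WITHOUT any information on the zeros of `ζ`: the analytic core
`GaussSaddle.abs_rpow_mul_card_sub_main_le` (Gaussian-smoothed Perron formula + second-order window + tails) is fed
with the elementary decay `|ζ(α+it, y)| ≤ ζ(α, y)/(log x)³` on `π/log y ≤ |t| ≤ κ y^{9/20}`
(`exists_norm_smoothZetaC_saddlePoint_le_div_log_cube`, from the classical prime number theorem, Chebyshev's bounds
and the Brun–Titchmarsh inequality), with the parameters `T_g = u/4`, `W = √(140 log u)`,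
`T_d = (u/2)√(4 log u + 2 log log y + 2)`.

* `exists_card_smooth_saddle_regimeA` — **the theorem**: there are `C`, `y₀`, `u₀` with
  `|Ψ(x, y) - x^α ζ(α, y)/(α√(2πφ₂))| ≤ (C/u) · x^α ζ(α, y)/(α√(2πφ₂))`
  for all `y ≥ y₀`, `(log x)³ ≤ y ≤ x`, `u ≥ u₀`, `u ≥ (log log y)³`.

## References

* [HildebrandTenenbaum1986] A. Hildebrand, G. Tenenbaum, Trans. AMS 296 (1986) 265–290, Thm 1 and §4
  (held: `paper:doi-10-1090-s0002-9947-1986-0837811-1`, pp. 266, 277–281).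
-/

noncomputable section

open Complex MeasureTheory Real Set Filter

namespace Literature.NumberTheory.Sieve

/-! ### The theorem -/

open GaussSaddle RegimeA in
set_option maxHeartbeats 3200000 in
/-- **Hildebrand–Tenenbaum's Theorem 1 in the range `(log x)³ ≤ y`, `u ≥ (log log y)³`, without zero-free regions.**
There are `C`, `y₀`, `u₀` such that for all real `x` and natural `y` with `y ≥ y₀`, `(log x)³ ≤ y ≤ x`,
`u = log x/log y ≥ u₀` and `u ≥ (log log y)³`:
`|Ψ(x, y) - x^α ζ(α, y)/(α√(2πφ₂(α, y)))| ≤ (C/u) · x^α ζ(α, y)/(α√(2πφ₂(α, y)))`, `α = α(x, y)`.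
[cite: HildebrandTenenbaum1986, Thm 1 (2.3), in the range (log x)³ ≤ y ≤ exp((log x)/(log log x)^{3})] -/
theorem exists_card_smooth_saddle_regimeA :
    ∃ C : ℝ, ∃ y₀ : ℕ, ∃ u₀ : ℝ, ∀ (x : ℝ) (y : ℕ), y₀ ≤ y → Real.log x ^ 3 ≤ y → (y : ℝ) ≤ x →
      u₀ ≤ Real.log x / Real.log y → Real.log (Real.log y) ^ 3 ≤ Real.log x / Real.log y →
      |((Nat.smoothNumbersUpTo ⌊x⌋₊ (y + 1)).card : ℝ) -
          x ^ saddlePoint x y * smoothZeta (saddlePoint x y) y /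
            (saddlePoint x y * Real.sqrt (2 * Real.pi * saddlePhi₂ (saddlePoint x y) y))| ≤
        C / (Real.log x / Real.log y) * (x ^ saddlePoint x y * smoothZeta (saddlePoint x y) y /
            (saddlePoint x y * Real.sqrt (2 * Real.pi * saddlePhi₂ (saddlePoint x y) y))) := by
  obtain ⟨x35, h35⟩ := three_fifths_le_saddlePoint
  obtain ⟨clo, x₂, hclo, hlo⟩ := le_rpow_one_sub_saddlePoint
  obtain ⟨cφ, x₃, hcφ, hφlo⟩ := le_saddlePhi₂_saddlePoint
  obtain ⟨x₄, hφup⟩ := saddlePhi₂_saddlePoint_le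
  obtain ⟨y₅, u₅, κ, hκ, hdecay⟩ := exists_norm_smoothZetaC_saddlePoint_le_div_log_cube
  -- ### eventual conditions in `u`
  have hev := ((eventually_log_rpow_le 1 (s := 1) (c := 9 * cφ / 140) (by norm_num) (by positivity)).and
    ((eventually_log_rpow_le 3 (s := 1) (c := 9 * cφ / 68600000) (by norm_num) (by positivity)).and
    ((eventually_log_rpow_le 2 (s := 1) (c := cφ / 1450400) (by norm_num) (by positivity)).and
    ((eventually_log_rpow_le 1 (s := 1 / 3) (c := 1) (by norm_num) (by norm_num)).and
    (eventually_ge_atTop (max (max 16 (2 / clo)) u₅))))))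
  obtain ⟨U, hU⟩ := Filter.eventually_atTop.1 hev
  set CK : ℝ := 4 + 5500 / cφ + 860000 / cφ ^ 2 with hCK
  have hCK0 : 0 < CK := by positivity
  refine ⟨500 + 2500 / cφ + 400000 / cφ ^ 2,
    max (max (max ⌈x35⌉₊ ⌈x₂⌉₊) (max ⌈x₃⌉₊ ⌈x₄⌉₊)) (max (max y₅ ⌈Real.exp 4⌉₊) ⌈(9 / (4 * κ ^ 2) + 1) ^ (9 : ℕ)⌉₊),
    U, fun x y hy hxy3 hyx hu hLL => ?_⟩
  -- ### unpack the `y`-thresholds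
  have hyA : max (max ⌈x35⌉₊ ⌈x₂⌉₊) (max ⌈x₃⌉₊ ⌈x₄⌉₊) ≤ y := le_trans (le_max_left _ _) hy
  have hyB : max (max y₅ ⌈Real.exp 4⌉₊) ⌈(9 / (4 * κ ^ 2) + 1) ^ (9 : ℕ)⌉₊ ≤ y := le_trans (le_max_right _ _) hy
  have hceil : ∀ {z : ℝ} {n : ℕ}, ⌈z⌉₊ ≤ n → z ≤ n := fun h => le_trans (Nat.le_ceil _) (by exact_mod_cast h)
  have hx35y : x35 ≤ y := hceil (le_trans (le_max_left _ _) (le_trans (le_max_left _ _) hyA))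
  have hx₂y : x₂ ≤ y := hceil (le_trans (le_max_right _ _) (le_trans (le_max_left _ _) hyA))
  have hx₃y : x₃ ≤ y := hceil (le_trans (le_max_left _ _) (le_trans (le_max_right _ _) hyA))
  have hx₄y : x₄ ≤ y := hceil (le_trans (le_max_right _ _) (le_trans (le_max_right _ _) hyA))
  have hy₅ : y₅ ≤ y := le_trans (le_max_left _ _) (le_trans (le_max_left _ _) hyB)
  have hye4 : Real.exp 4 ≤ y := hceil (le_trans (le_max_right _ _) (le_trans (le_max_left _ _) hyB))
  have hyκ : (9 / (4 * κ ^ 2) + 1) ^ (9 : ℕ) ≤ (y : ℝ) := hceil (le_trans (le_max_right _ _) hyB)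
  have he4 : (16 : ℝ) ≤ Real.exp 4 := by
    have h2 : Real.exp 4 = Real.exp 2 * Real.exp 2 := by rw [← Real.exp_add]; norm_num
    have h4 : (4 : ℝ) ≤ Real.exp 2 := by
      have h5 : Real.exp 2 = Real.exp 1 * Real.exp 1 := by rw [← Real.exp_add]; norm_num
      rw [h5]; nlinarith only [Real.exp_one_gt_d9]
    rw [h2]; nlinarith only [h4]
  have hy0 : (0 : ℝ) < y := by linarith only [he4, hye4]
  have hy1 : (1 : ℝ) < y := by linarith only [he4, hye4]
  have hy2 : 2 ≤ y := by exact_mod_cast (show (2 : ℝ) ≤ y by linarith only [he4, hye4])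
  set L : ℝ := Real.log y with hL
  have hL4 : 4 ≤ L := by have := Real.log_le_log (Real.exp_pos 4) hye4; rwa [Real.log_exp] at this
  have hL0 : 0 < L := by linarith only [hL4]
  have hL1 : 1 ≤ L := by linarith only [hL4]
  have hx1 : 1 < x := lt_of_lt_of_le hy1 hyx
  have hx0 : 0 < x := by linarith only [hx1]
  have hlogx : L ≤ Real.log x := Real.log_le_log hy0 hyx
  have hlogx0 : 0 < Real.log x := by linarith only [hlogx, hL4]
  set u : ℝ := Real.log x / L with hudef
  obtain ⟨hE1, hE2, hE3, hE4, hU0⟩ := hU u hu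
  simp only [Real.rpow_one, one_mul, Real.rpow_ofNat] at hE1 hE2 hE3 hE4
  have hu16 : 16 ≤ u := le_trans (le_max_left _ _) (le_trans (le_max_left _ _) hU0)
  have huclo : 2 / clo ≤ u := le_trans (le_max_right _ _) (le_trans (le_max_left _ _) hU0)
  have hu₅ : u₅ ≤ u := le_trans (le_max_right _ _) hU0
  have hu0 : 0 < u := by linarith only [hu16]
  have hu1 : 1 ≤ u := by linarith only [hu16]
  have huL : u * L = Real.log x := by rw [hudef]; field_simp
  set ℓ : ℝ := Real.log u with hℓ
  have hexpℓ : Real.exp ℓ = u := Real.exp_log hu0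
  have hℓ1 : 1 ≤ ℓ := by
    rw [hℓ, Real.le_log_iff_exp_le hu0]
    linarith only [Real.exp_one_lt_d9, hu16]
  have hℓ0 : 0 < ℓ := by linarith only [hℓ1]
  have hℓu : ℓ ≤ u - 1 := by rw [hℓ]; exact Real.log_le_sub_one_of_pos hu0
  -- `log L ≤ u^{1/3}`, `u ≤ log x ≤ y^{1/3}`
  have hlogL0 : 0 ≤ Real.log L := Real.log_nonneg hL1
  have hlogL : Real.log L ≤ u ^ (1 / 3 : ℝ) := by
    have h1 := Real.rpow_le_rpow (by positivity : 0 ≤ Real.log L ^ 3) hLL (by norm_num : (0 : ℝ) ≤ 1 / 3)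
    rwa [← Real.rpow_natCast, ← Real.rpow_mul hlogL0, show ((3 : ℕ) : ℝ) * (1 / 3) = 1 by norm_num,
      Real.rpow_one] at h1
  have hu13 : 1 ≤ u ^ (1 / 3 : ℝ) := Real.one_le_rpow hu1 (by norm_num)
  have hu13' : u ^ (1 / 3 : ℝ) ≤ u := by
    calc u ^ (1 / 3 : ℝ) ≤ u ^ (1 : ℝ) := Real.rpow_le_rpow_of_exponent_le hu1 (by norm_num)
      _ = u := Real.rpow_one u
  have hulogx : u ≤ Real.log x := by rw [hudef]; exact div_le_self hlogx0.le hL1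
  have hu3y : u ^ 3 ≤ y := le_trans (pow_le_pow_left₀ hu0.le hulogx 3) hxy3
  -- ### the saddle point, `φ`, `ζ₀`
  have hxx : ∀ z : ℝ, z ≤ y → z ≤ x := fun z hz => hz.trans hyx
  set α : ℝ := saddlePoint x y with hαdef
  have hα35 : 3 / 5 ≤ α := h35 x y (hxx _ hx35y) hxy3 hyx
  have hα0 : 0 < α := by linarith only [hα35]
  have hα1 : α ≤ 1 := by
    by_contra h
    push Not at h
    have hElo : clo * (u * Real.log (u + 1)) ≤ (y : ℝ) ^ (1 - α) := by
      have := hlo x y (hxx _ hx₂y) hxy3 hyx; rwa [← hudef] at this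
    have h1 : (y : ℝ) ^ (1 - α) ≤ 1 := Real.rpow_le_one_of_one_le_of_nonpos hy1.le (by linarith only [h])
    have h2 : 1 ≤ Real.log (u + 1) := by
      rw [Real.le_log_iff_exp_le (by linarith only [hu16])]
      linarith only [Real.exp_one_lt_d9, hu16]
    have h3 : 2 ≤ clo * u := by rwa [div_le_iff₀ hclo, mul_comm] at huclo
    have h4 : clo * u * 1 ≤ clo * u * Real.log (u + 1) := mul_le_mul_of_nonneg_left h2 (by positivity)
    linarith only [hElo, h1, h3, h4]
  have hαL : 1 ≤ α * L := by nlinarith only [hα35, hL4]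
  set φ : ℝ := saddlePhi₂ α y with hφdef
  have hφ0 : 0 < φ := saddlePhi₂_pos hy2 hα0
  have hφlo2 : cφ * u * L ^ 2 ≤ φ := by
    have := hφlo x y (hxx _ hx₃y) hxy3 hyx; rw [← huL] at this
    calc cφ * u * L ^ 2 = cφ * (u * L * L) := by ring
      _ ≤ φ := this
  have hφup2 : φ ≤ 3 * u * L ^ 2 := by
    have := hφup x y (hxx _ hx₄y) hxy3 hyx; rw [← huL] at this
    calc φ ≤ 3 * (u * L) * L := this
      _ = 3 * u * L ^ 2 := by ring
  have hφlo1 : cφ * u ≤ φ := le_trans (le_mul_of_one_le_right (by positivity) (one_le_pow₀ hL1)) hφlo2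
  set sφ : ℝ := Real.sqrt φ with hsφ
  have hsφ0 : 0 < sφ := Real.sqrt_pos.2 hφ0
  have hsφsq : sφ ^ 2 = φ := Real.sq_sqrt hφ0.le
  have hsφlo : Real.sqrt cφ * Real.sqrt u * L ≤ sφ := by
    rw [hsφ, ← Real.sqrt_mul hcφ.le, show Real.sqrt (cφ * u) * L = Real.sqrt (cφ * u * L ^ 2) by
      rw [Real.sqrt_mul (show (0 : ℝ) ≤ cφ * u by positivity) (L ^ 2), Real.sqrt_sq hL0.le]]
    exact Real.sqrt_le_sqrt hφlo2
  set ζ₀ : ℝ := smoothZeta α y with hζ₀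
  have hζ0 : 0 < ζ₀ := smoothZeta_pos hα0
  -- ### the parameters
  set Tg : ℝ := u / 4 with hTg
  have hTg4 : 4 ≤ Tg := by rw [hTg]; linarith only [hu16]
  have hTg0 : 0 < Tg := by linarith only [hTg4]
  set W : ℝ := Real.sqrt (140 * ℓ) with hW
  have hW0 : 0 < W := Real.sqrt_pos.2 (by positivity)
  have hWsq : W ^ 2 = 140 * ℓ := Real.sq_sqrt (by positivity)
  set D : ℝ := 4 * ℓ + 2 * Real.log L + 2 with hD
  have hD4 : 4 ≤ D := by rw [hD]; linarith only [hℓ1, hlogL0]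
  have hD0 : 0 < D := by linarith only [hD4]
  have hDu : D ≤ 7 * u := by
    rw [hD]; linarith only [hℓu, hlogL.trans hu13', hu1]
  have hDu3 : D ≤ 9 * u ^ (1 / 3 : ℝ) := by rw [hD]; linarith only [hE4, hlogL, hu13]
  set Td : ℝ := u / 2 * Real.sqrt D with hTd
  have hsD2 : 2 ≤ Real.sqrt D := by
    rw [show (2 : ℝ) = Real.sqrt 4 by rw [show (4 : ℝ) = 2 ^ 2 by norm_num, Real.sqrt_sq (by norm_num)]]
    exact Real.sqrt_le_sqrt hD4
  have hTdu : u ≤ Td := by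
    rw [hTd]; have := mul_le_mul_of_nonneg_left hsD2 (by positivity : (0 : ℝ) ≤ u / 2); linarith only [this]
  have hTd3 : 3 ≤ Td := by linarith only [hTdu, hu16]
  have hTd0 : 0 < Td := by linarith only [hTdu, hu16]
  set ε : ℝ := 1 / (u * L) ^ 3 with hε
  have hε0 : 0 ≤ ε := by positivity
  have hεlog : ζ₀ / Real.log x ^ 3 = ζ₀ * ε := by rw [hε, ← huL]; field_simp
  -- `T_d ≤ κ y^{9/20}` (compare squares: `T_d² ≤ (9/4) u^{7/3} ≤ (9/4) y^{7/9} ≤ κ² y^{9/10}`)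
  have hTdκ : Td ≤ κ * (y : ℝ) ^ (9 / 20 : ℝ) := by
    have hTdsq : Td ^ 2 = u ^ 2 / 4 * D := by rw [hTd, mul_pow, Real.sq_sqrt hD0.le]; ring
    have hT2 : Td ^ 2 ≤ 9 / 4 * (u ^ 2 * u ^ (1 / 3 : ℝ)) := by
      rw [hTdsq]
      have := mul_le_mul_of_nonneg_left hDu3 (by positivity : (0 : ℝ) ≤ u ^ 2 / 4)
      linarith only [this]
    have hu73 : u ^ 2 * u ^ (1 / 3 : ℝ) = u ^ (7 / 3 : ℝ) := by
      rw [show (7 / 3 : ℝ) = 2 + 1 / 3 by norm_num, Real.rpow_add hu0, show ((2 : ℝ)) = ((2 : ℕ) : ℝ) by norm_num,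
        Real.rpow_natCast]
    have hy79 : u ^ (7 / 3 : ℝ) ≤ (y : ℝ) ^ (7 / 9 : ℝ) := by
      have h1 : u ≤ (y : ℝ) ^ (1 / 3 : ℝ) := by
        have := Real.rpow_le_rpow (by positivity) hu3y (by norm_num : (0 : ℝ) ≤ 1 / 3)
        rwa [← Real.rpow_natCast, ← Real.rpow_mul hu0.le, show ((3 : ℕ) : ℝ) * (1 / 3) = 1 by norm_num,
          Real.rpow_one] at this
      calc u ^ (7 / 3 : ℝ) ≤ ((y : ℝ) ^ (1 / 3 : ℝ)) ^ (7 / 3 : ℝ) := Real.rpow_le_rpow hu0.le h1 (by norm_num)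
        _ = (y : ℝ) ^ (7 / 9 : ℝ) := by rw [← Real.rpow_mul hy0.le]; norm_num
    have hygap : 9 / (4 * κ ^ 2) ≤ (y : ℝ) ^ (11 / 90 : ℝ) := by
      have h2 : 9 / (4 * κ ^ 2) + 1 ≤ (y : ℝ) ^ (1 / 9 : ℝ) := by
        have := Real.rpow_le_rpow (by positivity) hyκ (by norm_num : (0 : ℝ) ≤ 1 / 9)
        rwa [← Real.rpow_natCast, ← Real.rpow_mul (by positivity), show ((9 : ℕ) : ℝ) * (1 / 9) = 1 by norm_num,
          Real.rpow_one] at this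
      have h3 : (y : ℝ) ^ (1 / 9 : ℝ) ≤ (y : ℝ) ^ (11 / 90 : ℝ) :=
        Real.rpow_le_rpow_of_exponent_le hy1.le (by norm_num)
      have h4 : 0 < (1 : ℝ) := one_pos
      linarith only [h2, h3, h4]
    have h79 : 0 ≤ (y : ℝ) ^ (7 / 9 : ℝ) := Real.rpow_nonneg hy0.le _
    have hsq : Td ^ 2 ≤ (κ * (y : ℝ) ^ (9 / 20 : ℝ)) ^ 2 := by
      have hy910 : (κ * (y : ℝ) ^ (9 / 20 : ℝ)) ^ 2 = κ ^ 2 * ((y : ℝ) ^ (11 / 90 : ℝ) * (y : ℝ) ^ (7 / 9 : ℝ)) := by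
        rw [mul_pow, ← Real.rpow_natCast ((y : ℝ) ^ (9 / 20 : ℝ)), ← Real.rpow_mul hy0.le, ← Real.rpow_add hy0]
        norm_num
      rw [hy910]
      calc Td ^ 2 ≤ 9 / 4 * u ^ (7 / 3 : ℝ) := by rw [← hu73]; exact hT2
        _ ≤ 9 / 4 * (y : ℝ) ^ (7 / 9 : ℝ) := by linarith only [hy79]
        _ = κ ^ 2 * (9 / (4 * κ ^ 2) * (y : ℝ) ^ (7 / 9 : ℝ)) := by field_simp
        _ ≤ κ ^ 2 * ((y : ℝ) ^ (11 / 90 : ℝ) * (y : ℝ) ^ (7 / 9 : ℝ)) :=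
            mul_le_mul_of_nonneg_left (mul_le_mul_of_nonneg_right hygap h79) (sq_nonneg κ)
    exact pow_le_pow_iff_left₀ hTd0.le (by positivity) two_ne_zero |>.1 hsq
  -- ### the hypotheses of the analytic core
  have hτ : W / Real.sqrt φ ≤ Real.pi / L := by
    rw [← hsφ, div_le_div_iff₀ hsφ0 hL0]
    have h1 : W ≤ 3 * (Real.sqrt cφ * Real.sqrt u) := by
      rw [hW, ← Real.sqrt_mul hcφ.le, show (3 : ℝ) * Real.sqrt (cφ * u) = Real.sqrt (3 ^ 2 * (cφ * u)) by
        rw [Real.sqrt_mul (show (0 : ℝ) ≤ 3 ^ 2 by norm_num) (cφ * u), Real.sqrt_sq (by norm_num)]]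
      refine Real.sqrt_le_sqrt ?_
      have h8 : (3 : ℝ) ^ 2 * (cφ * u) = 140 * (9 * cφ / 140 * u) := by ring
      rw [h8]; linarith only [hE1]
    have h2 : 3 * (Real.sqrt cφ * Real.sqrt u * L) ≤ Real.pi * sφ :=
      mul_le_mul Real.pi_gt_three.le hsφlo (by positivity) Real.pi_pos.le
    calc W * L ≤ 3 * (Real.sqrt cφ * Real.sqrt u) * L := by gcongr
      _ = 3 * (Real.sqrt cφ * Real.sqrt u * L) := by ring
      _ ≤ Real.pi * sφ := h2
  have hy1' : Real.pi / L ≤ 1 := by rw [div_le_one hL0]; linarith only [Real.pi_lt_d2, hL4]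
  have hdec : ∀ t : ℝ, Real.pi / L ≤ |t| → |t| ≤ Td → ‖smoothZetaC ((α : ℂ) + t * I) y‖ ≤ ζ₀ * ε := by
    intro t ht1 ht2
    rw [← hεlog]
    exact hdecay x y hy₅ hxy3 hyx hu₅ hLL t ht1 (ht2.trans hTdκ)
  have hsmall : saddlePhi₃ α y / 6 * (W / Real.sqrt φ) ^ 3 + saddlePhi₄ α y * (W / Real.sqrt φ) ^ 4 ≤ 1 := by
    rw [← hsφ]
    have hP3 := saddlePhi₃_le_mul_saddlePhi₂ hα35 y
    have hP4 := saddlePhi₄_le_mul_saddlePhi₂ hα35 y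
    rw [← hL, ← hφdef] at hP3 hP4
    have hP30 : 0 ≤ saddlePhi₃ α y := saddlePhi₃_nonneg hα0 y
    have hP40 : 0 ≤ saddlePhi₄ α y := saddlePhi₄_nonneg hα0 y
    have hτ2 : (W / sφ) ^ 2 = 140 * ℓ / φ := by rw [div_pow, hWsq, hsφsq]
    have hτ0 : 0 ≤ W / sφ := by positivity
    -- first term: `Φ₃/6 τ³ ≤ (350/3) L ℓ W/√φ ≤ 1/2`
    have hA : saddlePhi₃ α y / 6 * (W / sφ) ^ 3 ≤ 1 / 2 := by
      have h1 : saddlePhi₃ α y / 6 * (W / sφ) ^ 3 ≤ 5 * L * φ / 6 * (W / sφ) ^ 3 := by gcongr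
      have h2 : 5 * L * φ / 6 * (W / sφ) ^ 3 = 350 / 3 * L * ℓ * W / sφ := by
        rw [show (W / sφ) ^ 3 = (W / sφ) ^ 2 * (W / sφ) by ring, hτ2]; field_simp; ring
      rw [h2] at h1
      refine h1.trans ?_
      rw [div_le_div_iff₀ hsφ0 (by norm_num)]
      -- `(700/3) L ℓ W ≤ sφ`, from `(700/3) ℓ W ≤ √(cφ u)` (i.e. `(700/3)² 140 ℓ³ ≤ cφ u`) and `sφ ≥ √(cφ u) L`
      have h3 : 700 / 3 * ℓ * W ≤ Real.sqrt cφ * Real.sqrt u := by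
        rw [hW, ← Real.sqrt_mul hcφ.le,
          show 700 / 3 * ℓ * Real.sqrt (140 * ℓ) = Real.sqrt ((700 / 3 * ℓ) ^ 2 * (140 * ℓ)) by
            rw [Real.sqrt_mul (sq_nonneg (700 / 3 * ℓ)) (140 * ℓ), Real.sqrt_sq (by positivity)]]
        refine Real.sqrt_le_sqrt ?_
        have h6 : (700 / 3 * ℓ) ^ 2 * (140 * ℓ) = 68600000 / 9 * ℓ ^ 3 := by ring
        rw [h6]
        have h7 : 68600000 / 9 * (9 * cφ / 68600000 * u) = cφ * u := by ring
        linarith only [hE2, h7]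
      have h4 := mul_le_mul_of_nonneg_right h3 hL0.le
      have h5 : 350 / 3 * L * ℓ * W * 2 = 700 / 3 * ℓ * W * L := by ring
      rw [h5, one_mul]
      exact h4.trans hsφlo
    -- second term: `Φ₄ τ⁴ ≤ 725200 L² ℓ²/φ ≤ 1/2`
    have hB : saddlePhi₄ α y * (W / sφ) ^ 4 ≤ 1 / 2 := by
      have h1 : saddlePhi₄ α y * (W / sφ) ^ 4 ≤ 37 * L ^ 2 * φ * (W / sφ) ^ 4 := by gcongr
      have h2 : 37 * L ^ 2 * φ * (W / sφ) ^ 4 = 725200 * L ^ 2 * ℓ ^ 2 / φ := by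
        rw [show (W / sφ) ^ 4 = ((W / sφ) ^ 2) ^ 2 by ring, hτ2]; field_simp; ring
      rw [h2] at h1
      refine h1.trans ?_
      rw [div_le_div_iff₀ hφ0 (by norm_num)]
      have h3 := mul_le_mul_of_nonneg_right hE3 (by positivity : (0 : ℝ) ≤ L ^ 2)
      have h4 : 725200 * L ^ 2 * ℓ ^ 2 * 2 = 1450400 * (ℓ ^ 2 * L ^ 2) := by ring
      have h5 : 1450400 * (cφ / 1450400 * u * L ^ 2) = cφ * u * L ^ 2 := by ring
      rw [h4, one_mul]
      linarith only [h3, h5, hφlo2]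
    linarith only [hA, hB]
  have hKw := window_bound_le (P3 := saddlePhi₃ α y) (P4 := saddlePhi₄ α y) (Tg := Tg) (W := W) hα35 hα1 hφ0 hcφ
    hφlo2 hL1 hu16
    (show Real.exp (-(35 * ℓ)) ≤ 1 / u by
      rw [← hexpℓ, one_div, ← Real.exp_neg]; exact Real.exp_le_exp.2 (by linarith))
    hℓ0.le (saddlePhi₃_nonneg hα0 y) (saddlePhi₄_nonneg hα0 y)
    (by have := saddlePhi₃_le_mul_saddlePhi₂ hα35 y; rwa [← hL] at this)
    (by have := saddlePhi₄_le_mul_saddlePhi₂ hα35 y; rwa [← hL] at this) hTg hW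
  have hKt := tail_bound_le (Tg := Tg) (W := W) (Td := Td) (D := D) (ε := ε) hα35 hα1 hφ0 hφup2 hL1 hu16 hexpℓ hℓ1
    hTg hW hD hDu hTd (by rw [hε])
  have hcore := abs_rpow_mul_card_sub_main_le (x := x) (y := y) (Tg := Tg) (W := W) (Td := Td) (ε := ε)
    (Kw := (4 + 5500 / cφ + 860000 / cφ ^ 2) * (1 / (α * Real.sqrt φ * u)))
    (Kt := 100 * (1 / (α * Real.sqrt φ * u))) hx1 hy2 hα35 hα1 hαL hTg4 hW0 hτ hy1' hTd3 hε0 hdec hsmall hKw hKt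
  have hmean := mean_bound_le (Tg := Tg) (Td := Td) (D := D) (ε := ε) (ζ₀ := ζ₀) hα35 hα1 hφ0 hφup2 hL1 hu16 hexpℓ
    hℓ1 hTg hD hDu hTd (by rw [hε]) hζ0.le
  -- ### the final accounting
  rw [← hsφ] at hcore
  set m : ℝ := ζ₀ / (α * Real.sqrt (2 * Real.pi * φ)) with hm
  have hm0 : 0 ≤ m := by positivity
  set ν : ℝ := 1 / (α * sφ * u) with hν
  set P : ℝ := x ^ (-α) * ((Nat.smoothNumbersUpTo ⌊x⌋₊ (y + 1)).card : ℝ) with hP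
  set Δ : ℝ := ζ₀ / (2 * Real.pi) * ((4 + 5500 / cφ + 860000 / cφ ^ 2) * ν + 100 * ν) with hΔ
  set RR : ℝ := 4 * Real.sqrt (2 * Real.pi) / Tg * (1 / (2 * Real.pi) * (ζ₀ * (Real.sqrt (Real.pi / (φ / 100)) +
    ε * (2 * Td) + Real.exp (-(Td ^ 2 / Tg ^ 2)) * Real.sqrt (Real.pi / (1 / Tg ^ 2))))) with hRR
  have hΔ0 : 0 ≤ Δ := by positivity
  -- `ζ₀ ν = √(2π) m/u`, so `Δ = (CK + 100) √(2π)/(2π) · m/u ≤ 0.42 (CK + 100) m/u`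
  obtain ⟨-, hs2π, -, -, -, -⟩ := sqrt_consts
  have hsqrt2πφ : Real.sqrt (2 * Real.pi * φ) = Real.sqrt (2 * Real.pi) * sφ := Real.sqrt_mul (by positivity) φ
  have hs2π0 : 0 < Real.sqrt (2 * Real.pi) := Real.sqrt_pos.2 (by positivity)
  have hζν : ζ₀ * ν = Real.sqrt (2 * Real.pi) * (m / u) := by
    rw [hν, hm, hsqrt2πφ]; field_simp
  have hΔle : Δ ≤ 0.42 * (CK + 100) * (m / u) := by
    have : Δ = (CK + 100) * (Real.sqrt (2 * Real.pi) / (2 * Real.pi)) * (m / u) := by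
      rw [hΔ, hCK, show ζ₀ / (2 * Real.pi) * ((4 + 5500 / cφ + 860000 / cφ ^ 2) * ν + 100 * ν) =
        (4 + 5500 / cφ + 860000 / cφ ^ 2 + 100) / (2 * Real.pi) * (ζ₀ * ν) by ring, hζν]
      ring
    rw [this]
    have hπ3 := Real.pi_gt_three
    have h1 : Real.sqrt (2 * Real.pi) / (2 * Real.pi) ≤ 0.42 := by
      rw [div_le_iff₀ (by positivity)]; linarith only [hs2π, Real.pi_gt_d2]
    have hmu : 0 ≤ m / u := div_nonneg hm0 hu0.le
    calc (CK + 100) * (Real.sqrt (2 * Real.pi) / (2 * Real.pi)) * (m / u) ≤ (CK + 100) * 0.42 * (m / u) := by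
          gcongr
      _ = 0.42 * (CK + 100) * (m / u) := by ring
  have hs : α ^ 2 / (2 * Tg ^ 2) ≤ 1 / (2 * u) := by
    rw [hTg, div_le_div_iff₀ (by positivity) (by positivity)]
    have : α ^ 2 ≤ 1 := pow_le_one₀ hα0.le hα1
    nlinarith only [mul_le_mul_of_nonneg_left this (by positivity : (0 : ℝ) ≤ 2 * u),
      mul_le_mul_of_nonneg_left hu16 hu0.le]
  have hRRle : RR ≤ 400 / u * m := hmean
  have habs : |P - m| ≤ α ^ 2 / (2 * Tg ^ 2) * (m + Δ) + Δ + RR := hcore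
  have hPm : |P - m| ≤ (500 + 2500 / cφ + 400000 / cφ ^ 2) * (m / u) := by
    have h1 : α ^ 2 / (2 * Tg ^ 2) * (m + Δ) ≤ 1 / (2 * u) * (m + Δ) :=
      mul_le_mul_of_nonneg_right hs (by positivity)
    have h2 : 1 / (2 * u) * (m + Δ) ≤ 1 / 2 * (m / u) + 1 / 32 * Δ := by
      rw [show 1 / (2 * u) * (m + Δ) = 1 / 2 * (m / u) + 1 / (2 * u) * Δ by field_simp]
      have : 1 / (2 * u) ≤ 1 / 32 := by
        apply one_div_le_one_div_of_le (by norm_num); linarith only [hu16]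
      nlinarith only [this, hΔ0]
    have h3 : 400 / u * m = 400 * (m / u) := by field_simp
    have hmu : 0 ≤ m / u := div_nonneg hm0 hu0.le
    have hc1 : 0 ≤ 1 / cφ * (m / u) := by positivity
    have hc2 : 0 ≤ 1 / cφ ^ 2 * (m / u) := by positivity
    have h4 : 0.42 * (CK + 100) * (m / u) = 0.42 * (104 * (m / u) + 5500 * (1 / cφ * (m / u)) +
        860000 * (1 / cφ ^ 2 * (m / u))) := by rw [hCK]; ring
    have h5 : (500 + 2500 / cφ + 400000 / cφ ^ 2) * (m / u) =
        500 * (m / u) + 2500 * (1 / cφ * (m / u)) + 400000 * (1 / cφ ^ 2 * (m / u)) := by ring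
    rw [h5]
    rw [h4] at hΔle
    linarith only [habs, h1, h2, hRRle, h3, hΔle, hΔ0, hmu, hc1, hc2]
  -- ### back to `Ψ(x, y)`
  have hxα : 0 < x ^ α := Real.rpow_pos_of_pos hx0 α
  have hΨ : ((Nat.smoothNumbersUpTo ⌊x⌋₊ (y + 1)).card : ℝ) = x ^ α * P := by
    rw [hP, ← mul_assoc, ← Real.rpow_add hx0, add_neg_cancel, Real.rpow_zero, one_mul]
  have hmain : x ^ α * ζ₀ / (α * Real.sqrt (2 * Real.pi * φ)) = x ^ α * m := by rw [hm]; ring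
  rw [hΨ, hmain, ← mul_sub, abs_mul, abs_of_pos hxα]
  calc x ^ α * |P - m| ≤ x ^ α * ((500 + 2500 / cφ + 400000 / cφ ^ 2) * (m / u)) :=
        mul_le_mul_of_nonneg_left hPm hxα.le
    _ = (500 + 2500 / cφ + 400000 / cφ ^ 2) / u * (x ^ α * m) := by
        field_simp

end Literature.NumberTheory.Sieve

end
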